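import Literature.NumberTheory.EllipticCurves.ModularSymbolsManinGeneration
import Literature.NumberTheory.EllipticCurves.HidaOrdinaryProjector
import Mathlib.LinearAlgebra.Quotient.Basic
import Mathlib.GroupTheory.Index
import HarnessLib

/-!
# Sub- and quotient coefficient systems, finiteness of `Symb_Γ(V)`, and the ordinary projector on symbols

Three pieces of bookkeeping for the abstract modular symbols of `ModularSymbolsCoefficients`
(Greenberg 2007, §3: the approximation modules `A^N 𝔻⁰ = 𝔻⁰/F^N` and their symbols):

* **invariant submodules and quotients of a coefficient system** `A` on a multiplicatively closed `S`
  (`CoeffActionOn.restrict`, `CoeffActionOn.quotient`) with the inclusion / projection morphisms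
  (`inclHom`, `mkQHom`), hence `U_p`-equivariant maps `Symb(W) → Symb(V) → Symb(V/W)`
  (`ModularSymbolsCoefficients.Hom.mapFun_hecke`);
* **finiteness**: for `Γ` of finite index the Manin map to `V^{Γ\SL₂(ℤ)}` (`maninMapQuot`, from
  `maninMap_injective` with `reps = Quotient.out` on right cosets) is an injective linear map into a
  finite product, so `Symb_Γ(V)` is finite when `V` is (`finite_Symb`);
* consequently **Hida's ordinary projector `e = ordProj U` exists on `Symb_Γ(V)` for finite `V`** and any
  endomorphism `U` (e.g. `U_p = heckeSymb`), and is natural for `U`-equivariant maps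
  (`HidaOrdinaryProjector.map_ordProj`) — recorded here as `ordProjSymb` / `mapSymb_ordProjSymb`.

Brick B2j of the bottom-up plan recorded with the named fact
`greenbergStevens_kitagawa_twoVariable_interpolation_allBranches`.  Everything is proved; no named facts.

## References

* M. Greenberg, Israel J. Math. 161 (2007), §3. [Greenberg2007Lifting]
* Ju. I. Manin, Izv. 36 (1972), §1.6. [Manin1972]
-/

noncomputable section

open scoped MatrixGroups
open Matrix

namespace Literature.NumberTheory.EllipticCurves

namespace CoeffActionOn

variable {S : Set (Matrix (Fin 2) (Fin 2) ℤ)} {R V : Type*} [CommRing R] [AddCommGroup V] [Module R V]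
  (A : CoeffActionOn S R V)

/-! ### Invariant submodules and quotients -/

/-- A submodule `W` is **`A`-invariant** if `ρ(M) W ⊆ W` for all `M ∈ S`. [folklore] -/
def IsInvariant (W : Submodule R V) : Prop := ∀ M ∈ S, W ≤ W.comap (A.ρ M)

open Classical in
/-- The operator of `M` on an invariant submodule (`ρ(M)|_W` for `M ∈ S`, identity otherwise). [folklore] -/
def restrictρ {W : Submodule R V} (hW : A.IsInvariant W) (M : Matrix (Fin 2) (Fin 2) ℤ) : W →ₗ[R] W :=
  if h : M ∈ S then (A.ρ M).restrict (fun _ hw => hW M h hw) else LinearMap.id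

/-- Values of `restrictρ` on `S`. [folklore] -/
theorem restrictρ_apply {W : Submodule R V} (hW : A.IsInvariant W) {M : Matrix (Fin 2) (Fin 2) ℤ} (hM : M ∈ S) (w : W) :
    (A.restrictρ hW M w : V) = A.ρ M w := by
  rw [restrictρ, dif_pos hM]; rfl

/-- **The coefficient system restricted to an invariant submodule** (`S` multiplicatively closed).
[folklore] -/
def restrict (hS : ∀ M ∈ S, ∀ M' ∈ S, M * M' ∈ S) {W : Submodule R V} (hW : A.IsInvariant W) :
    CoeffActionOn S R W where
  ρ := A.restrictρ hW
  ρ_mul M hM M' hM' := by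
    refine LinearMap.ext fun w => Subtype.ext ?_
    rw [A.restrictρ_apply hW (hS M hM M' hM'), LinearMap.comp_apply, A.restrictρ_apply hW hM',
      A.restrictρ_apply hW hM, A.ρ_mul M hM M' hM', LinearMap.comp_apply]
  ρ_one := by
    classical
    by_cases h1 : (1 : Matrix (Fin 2) (Fin 2) ℤ) ∈ S
    · refine LinearMap.ext fun w => Subtype.ext ?_
      rw [A.restrictρ_apply hW h1, A.ρ_one]; rfl
    · rw [restrictρ, dif_neg h1]

/-- The operators of the restricted system. [folklore] -/
theorem restrict_ρ (hS : ∀ M ∈ S, ∀ M' ∈ S, M * M' ∈ S) {W : Submodule R V} (hW : A.IsInvariant W)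
    (M : Matrix (Fin 2) (Fin 2) ℤ) : (A.restrict hS hW).ρ M = A.restrictρ hW M := rfl

/-- **The inclusion of an invariant submodule is a morphism of coefficient systems.** [folklore] -/
def inclHom (hS : ∀ M ∈ S, ∀ M' ∈ S, M * M' ∈ S) {W : Submodule R V} (hW : A.IsInvariant W) :
    Hom (A.restrict hS hW) A where
  toLinearMap := W.subtype
  comm M hM w := by rw [Submodule.subtype_apply, Submodule.subtype_apply, restrict_ρ, A.restrictρ_apply hW hM]

open Classical in
/-- The operator of `M` on the quotient by an invariant submodule (`ρ(M) mod W` for `M ∈ S`, identity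
otherwise). [folklore] -/
def quotientρ {W : Submodule R V} (hW : A.IsInvariant W) (M : Matrix (Fin 2) (Fin 2) ℤ) : (V ⧸ W) →ₗ[R] (V ⧸ W) :=
  if h : M ∈ S then W.mapQ W (A.ρ M) (hW M h) else LinearMap.id

/-- Values of `quotientρ` on `S`. [folklore] -/
theorem quotientρ_mk {W : Submodule R V} (hW : A.IsInvariant W) {M : Matrix (Fin 2) (Fin 2) ℤ} (hM : M ∈ S) (v : V) :
    A.quotientρ hW M (Submodule.Quotient.mk v) = Submodule.Quotient.mk (A.ρ M v) := by
  rw [quotientρ, dif_pos hM, Submodule.mapQ_apply]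

/-- **The quotient coefficient system `V/W`** by an invariant submodule (`S` multiplicatively closed) —
e.g. Greenberg's approximation modules `A^N 𝔻⁰ = 𝔻⁰/F^N`. [cite: Greenberg2007Lifting, §3] -/
def quotient (hS : ∀ M ∈ S, ∀ M' ∈ S, M * M' ∈ S) {W : Submodule R V} (hW : A.IsInvariant W) :
    CoeffActionOn S R (V ⧸ W) where
  ρ := A.quotientρ hW
  ρ_mul M hM M' hM' := by
    refine LinearMap.ext fun x => ?_
    induction x using Submodule.Quotient.induction_on with
    | H v =>
      rw [A.quotientρ_mk hW (hS M hM M' hM'), LinearMap.comp_apply, A.quotientρ_mk hW hM, A.quotientρ_mk hW hM',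
        A.ρ_mul M hM M' hM', LinearMap.comp_apply]
  ρ_one := by
    classical
    by_cases h1 : (1 : Matrix (Fin 2) (Fin 2) ℤ) ∈ S
    · refine LinearMap.ext fun x => ?_
      induction x using Submodule.Quotient.induction_on with
      | H v => rw [A.quotientρ_mk hW h1, A.ρ_one]; rfl
    · rw [quotientρ, dif_neg h1]

/-- The operators of the quotient system. [folklore] -/
theorem quotient_ρ (hS : ∀ M ∈ S, ∀ M' ∈ S, M * M' ∈ S) {W : Submodule R V} (hW : A.IsInvariant W)
    (M : Matrix (Fin 2) (Fin 2) ℤ) : (A.quotient hS hW).ρ M = A.quotientρ hW M := rfl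

/-- **The projection to the quotient is a morphism of coefficient systems.** [folklore] -/
def mkQHom (hS : ∀ M ∈ S, ∀ M' ∈ S, M * M' ∈ S) {W : Submodule R V} (hW : A.IsInvariant W) :
    Hom A (A.quotient hS hW) where
  toLinearMap := W.mkQ
  comm M hM v := by rw [Submodule.mkQ_apply, Submodule.mkQ_apply, quotient_ρ, A.quotientρ_mk hW hM]

/-- The submodules `r V = range (r • id)` (e.g. `p^m V`) are invariant under every coefficient system.
[folklore] -/
theorem isInvariant_range_smul_id (r : R) : A.IsInvariant (LinearMap.range (r • (LinearMap.id : V →ₗ[R] V))) := by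
  intro M _ v hv
  rw [Submodule.mem_comap]
  obtain ⟨w, rfl⟩ := hv
  refine ⟨A.ρ M w, ?_⟩
  simp only [LinearMap.smul_apply, LinearMap.id_apply, map_smul]

/-! ### Finiteness of `Symb_Γ(V)` via the Manin map -/

/-- Right-coset representatives `Quotient.out` cover `SL₂(ℤ) = ⋃ Γ gᵢ`. [folklore] -/
theorem cover_rightRel (Γ : Subgroup SL(2, ℤ)) (g : SL(2, ℤ)) :
    ∃ (i : Quotient (QuotientGroup.rightRel Γ)) (γ : SL(2, ℤ)), γ ∈ Γ ∧
      g = γ * (Quotient.out i : SL(2, ℤ)) := by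
  refine ⟨Quotient.mk _ g, g * (Quotient.out (Quotient.mk (QuotientGroup.rightRel Γ) g) : SL(2, ℤ))⁻¹, ?_, by group⟩
  have h : (QuotientGroup.rightRel Γ) (Quotient.out (Quotient.mk (QuotientGroup.rightRel Γ) g)) g :=
    Quotient.exact (Quotient.out_eq _)
  rw [QuotientGroup.rightRel_apply] at h
  exact h

/-- **The Manin map on right cosets** `Symb_Γ(V) → V^{Γ\SL₂(ℤ)}`. [cite: Manin1972, §1.6] -/
def maninMapQuot (Γ : Subgroup SL(2, ℤ)) : A.Symb Γ →ₗ[R] (Quotient (QuotientGroup.rightRel Γ) → V) :=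
  A.maninMap Γ (fun i => (Quotient.out i : SL(2, ℤ)))

/-- **Injectivity of the Manin map on right cosets.** [cite: Manin1972, §1.6] -/
theorem maninMapQuot_injective (Γ : Subgroup SL(2, ℤ)) : Function.Injective (A.maninMapQuot Γ) :=
  A.maninMap_injective Γ _ (cover_rightRel Γ)

/-- The right coset space of a finite-index subgroup is finite. [folklore] -/
instance finite_rightRel_quotient (Γ : Subgroup SL(2, ℤ)) [Γ.FiniteIndex] :
    Finite (Quotient (QuotientGroup.rightRel Γ)) :=
  Finite.of_equiv _ (QuotientGroup.quotientRightRelEquivQuotientLeftRel Γ).symm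

/-- **`Symb_Γ(V)` is finite for finite `V` and `Γ` of finite index** (e.g. `Γ₀(N)`). [folklore] -/
instance finite_Symb (Γ : Subgroup SL(2, ℤ)) [Γ.FiniteIndex] [Finite V] : Finite (A.Symb Γ) :=
  Finite.of_injective _ (A.maninMapQuot_injective Γ)

/-! ### The ordinary projector on symbols with finite coefficients -/

/-- **Hida's ordinary projector on `Symb_Γ(V)`** for finite `V`, attached to an endomorphism `U` of
`Symb_Γ(V)` (e.g. `U = U_p = heckeSymb`): the projection onto `⋂ range Uⁿ` along `⋃ ker Uⁿ`.
[cite: Greenberg2007Lifting, §3] -/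
def ordProjSymb (Γ : Subgroup SL(2, ℤ)) [Γ.FiniteIndex] [Finite V] (U : Module.End R (A.Symb Γ)) :
    Module.End R (A.Symb Γ) :=
  HidaProjector.ordProj U

/-- `e` is idempotent on symbols. [folklore] -/
theorem ordProjSymb_idem (Γ : Subgroup SL(2, ℤ)) [Γ.FiniteIndex] [Finite V] (U : Module.End R (A.Symb Γ)) :
    (A.ordProjSymb Γ U).comp (A.ordProjSymb Γ U) = A.ordProjSymb Γ U :=
  HidaProjector.ordProj_idem U

/-- `e` commutes with `U`. [folklore] -/
theorem ordProjSymb_comm (Γ : Subgroup SL(2, ℤ)) [Γ.FiniteIndex] [Finite V] (U : Module.End R (A.Symb Γ)) :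
    (A.ordProjSymb Γ U).comp U = U.comp (A.ordProjSymb Γ U) :=
  HidaProjector.ordProj_comm_self U

variable {W : Type*} [AddCommGroup W] [Module R W] (B : CoeffActionOn S R W)

/-- The map on symbols induced by a morphism of coefficient systems (restriction of `Hom.mapFun`).
[folklore] -/
def mapSymb {Γ : Subgroup SL(2, ℤ)} (T : Hom A B) (hΓ : ∀ γ : SL(2, ℤ), γ ∈ Γ → (γ : Matrix (Fin 2) (Fin 2) ℤ) ∈ S) :
    A.Symb Γ →ₗ[R] B.Symb Γ :=
  T.mapFun.restrict fun _ hφ => T.mapFun_mem_Symb hΓ hφ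

/-- Unfolding `mapSymb`. [folklore] -/
@[simp] theorem coe_mapSymb {Γ : Subgroup SL(2, ℤ)} (T : Hom A B) (hΓ : ∀ γ : SL(2, ℤ), γ ∈ Γ → (γ : Matrix (Fin 2) (Fin 2) ℤ) ∈ S)
    (φ : A.Symb Γ) : ((mapSymb A B T hΓ φ : B.Symb Γ) : P1Q → P1Q → W) = T.mapFun φ := rfl

/-- **Naturality of the ordinary projector on symbols**: for endomorphisms `U, U'` intertwined by the
map of symbols induced by a morphism `T` (e.g. `U_p` on both sides, `Hom.mapFun_hecke`),
`mapSymb ∘ e = e' ∘ mapSymb`. [folklore] -/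
theorem mapSymb_ordProjSymb {Γ : Subgroup SL(2, ℤ)} [Γ.FiniteIndex] [Finite V] [Finite W] (T : Hom A B)
    (hΓ : ∀ γ : SL(2, ℤ), γ ∈ Γ → (γ : Matrix (Fin 2) (Fin 2) ℤ) ∈ S)
    {U : Module.End R (A.Symb Γ)} {U' : Module.End R (B.Symb Γ)}
    (hU : (mapSymb A B T hΓ).comp U = U'.comp (mapSymb A B T hΓ)) :
    (mapSymb A B T hΓ).comp (A.ordProjSymb Γ U) = (B.ordProjSymb Γ U').comp (mapSymb A B T hΓ) :=
  HidaProjector.map_ordProj hU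

end CoeffActionOn

end Literature.NumberTheory.EllipticCurves

end
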